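import Summits.QuantumFields.YangMills.Theorems.VirialFluxGapConstantHistoryDeficit
import Summits.QuantumFields.YangMills.Theorems.ToronValleyVolumeLojasiewiczLocaliseSeam
import HarnessLib

/-!
# The periodic ring deficit of a COMB-CONSTANT history is a commutator quartic — the `c`-only slice of the central chart ON THE TREE-GAUGED SPACE `X_fix`
# (free-hands helper toward crux ⟨stmt-QuantumFields-24141⟩ `VirialFluxGap.PeriodicSoftness`; LEAD seat ym-line-sfw-p2 gen 92, `--supports 24141 --as helper`)

Twin of ✓`VirialFluxGapConstantHistoryDeficit` in TREE GAUGE.  A COMB-CONSTANT ring history has every time slice equal to the comb-flat configuration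
`combFlat h` (✓`TwoLattice.Flat.combFlat`: the link `(x,k)` carries `h k` on the wrap layer `x_k = −1` and `1` elsewhere) and a constant seam field `x ↦ c`.
Through each of the 16 central flat histories these form the 12-dimensional family tangent to the zero modes of the Hessian of the zero-flux deficit on the
tree-gauged ring space `X_fix` (referee ruling 2026-08-30T23:30Z on the ym-idea-1 bus: the Euler field of the «virial» road is hosted on `X_fix`, where the
block-uniform frame directions on the three wrap layers and on the seam ARE the central zero modes).  Exactly as for constant histories:

* ★ `wilsonAction_combFlat` — `S(combFlat h) = L·Σ_{i<j} t(h_i h_j h_i⁻¹ h_j⁻¹)` (`t = 2 − Re tr`): only the `L` plaquettes of the `(i,j)` plane sitting on BOTH wrap layers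
  `x_i = x_j = −1` carry the commutator (✓`plaquetteHolonomy_combFlat`), counted by `card_filter_apply_eq_and` (two coordinates fixed ⇒ `L` sites);
* ★ `seamDeficit_combFlat` — `6L³ − T(combFlat h, c·(combFlat h)·c⁻¹) = L²·Σ_k t(h_k c h_k⁻¹ c⁻¹)`: the `L²` wrap links of layer `k` carry `[h_k, c]`
  (`card_filter_apply_eq`: one coordinate fixed ⇒ `L²` sites);
* ★★ `ringDeficit_combConst` — `F₀(comb-const h c) = 2L²·Σ_{i<j} t([h_i,h_j]) + L²·Σ_k t([h_k,c])` (✓`ringDeficit_constSlices`), and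
  `ringDeficit_combConst_eq_commutator_quartic` — `= 2L²·Σ_{i<j}‖A_iA_j − A_jA_i‖² + L²·Σ_k‖A_kC − CA_k‖²` in unit quaternions (✓`su2Deficit_commutator_eq`): a
  HOMOGENEOUS QUARTIC of the imaginary parts with weights `(2L², L²)` (vs `(2L⁴, L³)` for constant histories — the comb concentrates the holonomy on one layer);
* ★ `ringDeficit_combConst_eq_zero_iff` — zero iff `(h₀,h₁,h₂,c)` commute pairwise (cf. ✓`wilsonAction_combFlat_eq_zero` for the `⇐` half on one slice).

THEOREMS ONLY (no `def`, no `sorry`); comb-constant histories are written as lambdas.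

HONEST LABEL: exact lattice algebra on a 12-dimensional family of histories; nothing of ⟨24141⟩, a rung, a leaf or a summit is proved; the Yang–Mills mass gap is
NOT proved by this; no summit is proved by a line.

References: M. Lüscher, Nucl. Phys. B 219 (1983) 233–261, §2 (torons ∕ comb-flat representatives) [Luscher1983]; E. Seiler, LNP 159 (1982) §2 (maximal trees,
wrap links) [SeilerLNP1982]; A. Coste et al., Nucl. Phys. B 262 (1985) 67–94 (quartic zero-mode potential) [CosteEtAl1985].
-/

set_option autoImplicit false

noncomputable section

open scoped Quaternion BigOperators
open Literature.MathematicalPhysics.QuantumFieldTheory hiding SU2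
open Literature.MathematicalPhysics.QuantumLattice (su2Quat)
open Summit.QuantumFields.YangMills.Theorems.FemtoTransferGap
open Summit.QuantumFields.YangMills.Theorems.FemtoTransferGap.TwoLattice.Flat (combFlat combFlat_apply)
open Summit.QuantumFields.YangMills.Theorems.VirialFluxGap.RingDeficit
open Summit.QuantumFields.YangMills.Theorems.VirialFluxGap.ConstantHistory
open Summit.QuantumFields.YangMills.Theorems.ToronValleyVolume.Lojasiewicz (plaquetteHolonomy_combFlat)

namespace Summit.QuantumFields.YangMills.Theorems.VirialFluxGap.CombConstant

variable {L : ℕ} [NeZero L]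

/-! ## §1 Counting sites of `(ℤ/L)³` with one or two coordinates prescribed -/

/-- In `Fin 3`, the index `−(i+j)` is the third one: it differs from `i ≠ j` and every index other than `i, j` equals it. [folklore] -/
theorem fin3_third : ∀ i j : Fin 3, i ≠ j → (-(i + j) ≠ i ∧ -(i + j) ≠ j ∧ ∀ l : Fin 3, l ≠ i → l ≠ j → l = -(i + j)) := by
  decide

/-- Two coordinates prescribed: `#{x : (ℤ/L)³ | x_i = a ∧ x_j = b} = L` for `i ≠ j`. [folklore] -/
theorem card_filter_apply_eq_and {i j : Fin 3} (hij : i ≠ j) (a b : ZMod L) :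
    (Finset.univ.filter (fun x : Site 3 L => x i = a ∧ x j = b)).card = L := by
  obtain ⟨hki, hkj, hk⟩ := fin3_third i j hij
  set k : Fin 3 := -(i + j) with hkdef
  rw [← Fintype.card_subtype]
  let e : {x : Site 3 L // x i = a ∧ x j = b} ≃ ZMod L :=
    { toFun := fun x => x.1 k
      invFun := fun m => ⟨fun l => if l = i then a else if l = j then b else m, by
        refine ⟨by simp, ?_⟩
        simp [hij.symm]⟩
      left_inv := by
        rintro ⟨x, hxa, hxb⟩
        apply Subtype.ext
        funext l
        dsimp only
        by_cases h1 : l = i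
        · subst h1; simp [hxa]
        by_cases h2 : l = j
        · subst h2; simp [hij.symm, hxb]
        rw [if_neg h1, if_neg h2, hk l h1 h2]
      right_inv := fun m => by
        dsimp only
        rw [if_neg hki, if_neg hkj] }
  rw [Fintype.card_congr e, ZMod.card]

/-- One coordinate prescribed: `#{x : (ℤ/L)³ | x_i = a} = L²`. [folklore] -/
theorem card_filter_apply_eq (i : Fin 3) (a : ZMod L) :
    (Finset.univ.filter (fun x : Site 3 L => x i = a)).card = L ^ 2 := by
  rw [← Fintype.card_subtype]
  let e : {x : Site 3 L // x i = a} ≃ ({l : Fin 3 // l ≠ i} → ZMod L) :=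
    { toFun := fun x l => x.1 l.1
      invFun := fun f => ⟨fun l => if h : l = i then a else f ⟨l, h⟩, by simp⟩
      left_inv := by
        rintro ⟨x, hx⟩
        apply Subtype.ext
        funext l
        dsimp only
        by_cases h : l = i
        · subst h; simp [hx]
        · simp [h]
      right_inv := fun f => by
        funext ⟨l, hl⟩
        dsimp only
        simp [hl] }
  rw [Fintype.card_congr e, Fintype.card_fun, ZMod.card, Fintype.card_subtype_compl, Fintype.card_fin]
  simp

/-! ## §2 The Wilson action of a comb-flat configuration -/

/-- `t(1) = 0`. [folklore] -/
theorem su2Deficit_one' : su2Deficit (1 : SU2) = 0 := by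
  unfold su2Deficit
  simp [Matrix.trace_one]

omit [NeZero L] in
/-- The plaquette deficit of a comb-flat configuration: the commutator `[h_i, h_j]` on the sites with `x_i = x_j = −1`, nothing elsewhere. [cite: Luscher1983, §2] -/
theorem plaquetteDeficit_combFlat (h : Fin 3 → SU2) (x : Site 3 L) {i j : Fin 3} (hij : i ≠ j) :
    su2Deficit (plaquetteHolonomy (combFlat (L := L) h) x i j) =
      if x i = -1 ∧ x j = -1 then su2Deficit (h i * h j * (h i)⁻¹ * (h j)⁻¹) else 0 := by
  rw [plaquetteHolonomy_combFlat h x hij, combFlat_apply, combFlat_apply]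
  dsimp only
  by_cases hx : x i = -1
  · by_cases hy : x j = -1
    · rw [if_pos hx, if_pos hy, if_pos ⟨hx, hy⟩]
    · rw [if_pos hx, if_neg hy, if_neg (show ¬(x i = -1 ∧ x j = -1) from fun h' => hy h'.2)]
      rw [mul_one, inv_one, mul_one, mul_inv_cancel, su2Deficit_one']
  · rw [if_neg hx, if_neg (show ¬(x i = -1 ∧ x j = -1) from fun h' => hx h'.1)]
    by_cases hy : x j = -1
    · rw [if_pos hy, one_mul, inv_one, mul_one, mul_inv_cancel, su2Deficit_one']
    · rw [if_neg hy, one_mul, inv_one, mul_one, mul_one, su2Deficit_one']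

/-- ★ **Wilson action of a comb-flat configuration**: `S(combFlat h) = L·Σ_{i<j} t(h_i h_j h_i⁻¹ h_j⁻¹)`. [cite: Luscher1983, §2] [cite: SeilerLNP1982, §2] -/
theorem wilsonAction_combFlat (h : Fin 3 → SU2) :
    wilsonAction su2Rep (combFlat (L := L) h) =
      (L : ℝ) * ∑ p : {p : Fin 3 × Fin 3 // p.1 < p.2}, su2Deficit (h p.1.1 * h p.1.2 * (h p.1.1)⁻¹ * (h p.1.2)⁻¹) := by
  unfold wilsonAction
  rw [Fintype.sum_prod_type, Finset.sum_comm, Finset.mul_sum]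
  refine Finset.sum_congr rfl fun p _ => ?_
  have hij : p.1.1 ≠ p.1.2 := ne_of_lt p.2
  have e1 : ∀ x : Site 3 L, ((2 : ℕ) : ℝ) - ((su2Rep (plaquetteHolonomy (combFlat (L := L) h) x p.1.1 p.1.2)).trace).re =
      if x p.1.1 = -1 ∧ x p.1.2 = -1 then su2Deficit (h p.1.1 * h p.1.2 * (h p.1.1)⁻¹ * (h p.1.2)⁻¹) else 0 := by
    intro x
    rw [Nat.cast_ofNat, two_sub_re_trace_su2Rep, plaquetteDeficit_combFlat h x hij]
  simp_rw [e1]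
  rw [← Finset.sum_filter, Finset.sum_const, card_filter_apply_eq_and hij, nsmul_eq_mul]

/-! ## §3 The seam bond of a comb-constant history -/

/-- The seam bond of a comb-constant history: `6L³ − T(combFlat h, c·(combFlat h)·c⁻¹) = L²·Σ_k t(h_k c h_k⁻¹ c⁻¹)`. [cite: Luscher1983, §2] -/
theorem seamDeficit_combFlat (h : Fin 3 → SU2) (c : SU2) :
    6 * (L : ℝ) ^ 3 - timeCoupling su2Rep (combFlat (L := L) h) (gaugeTransform (fun _ : Site 3 L => c) (combFlat (L := L) h)) =
      (L : ℝ) ^ 2 * ∑ k : Fin 3, su2Deficit (h k * c * (h k)⁻¹ * c⁻¹) := by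
  have hcardS : Fintype.card (Site 3 L) = L ^ 3 := card_site_three L
  have hcardE : (Fintype.card (Edge 3 L) : ℝ) = 3 * (L : ℝ) ^ 3 := by
    rw [Fintype.card_prod, hcardS, Fintype.card_fin]; push_cast; ring
  -- `6L³ = Σ_e 2`
  have h6 : 6 * (L : ℝ) ^ 3 = ∑ _e : Edge 3 L, (2 : ℝ) := by
    rw [Finset.sum_const, Finset.card_univ, nsmul_eq_mul, hcardE]; ring
  unfold timeCoupling
  rw [h6, ← Finset.sum_sub_distrib]
  -- per link
  have e1 : ∀ e : Edge 3 L, (2 : ℝ) - ((su2Rep (combFlat (L := L) h e * (gaugeTransform (fun _ : Site 3 L => c) (combFlat (L := L) h) e)⁻¹)).trace).re =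
      if e.1 e.2 = -1 then su2Deficit (h e.2 * c * (h e.2)⁻¹ * c⁻¹) else 0 := by
    intro e
    have hg : gaugeTransform (fun _ : Site 3 L => c) (combFlat (L := L) h) e = c * combFlat h e * c⁻¹ := rfl
    rw [hg, combFlat_apply]
    by_cases hx : e.1 e.2 = -1
    · rw [if_pos hx, if_pos hx, two_sub_re_trace_su2Rep]
      congr 1; group
    · rw [if_neg hx, if_neg hx, two_sub_re_trace_su2Rep]
      have : (1 : SU2) * (c * 1 * c⁻¹)⁻¹ = 1 := by group
      rw [this, su2Deficit_one']
  simp_rw [e1]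
  rw [Fintype.sum_prod_type, Finset.sum_comm, Finset.mul_sum]
  refine Finset.sum_congr rfl fun k _ => ?_
  dsimp only
  rw [← Finset.sum_filter, Finset.sum_const, card_filter_apply_eq k, nsmul_eq_mul]
  push_cast; ring

/-! ## §4 ★★ The deficit of a comb-constant history -/

/-- ★★ **THE DEFICIT OF A COMB-CONSTANT HISTORY** (every slice `combFlat h`, constant seam field `c`):
`F₀ = 2L²·Σ_{i<j} t([h_i,h_j]) + L²·Σ_k t([h_k,c])`. [cite: Luscher1983, §2] [cite: MontvayMunster1994, (3.145)] -/
theorem ringDeficit_combConst (h : Fin 3 → SU2) (c : SU2) :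
    ringDeficit L (fun _ => false) (fun _ : Fin (2 * L - 1 + 1) => combFlat (L := L) h, fun _ : Site 3 L => c) =
      2 * (L : ℝ) ^ 2 * ∑ p : {p : Fin 3 × Fin 3 // p.1 < p.2}, su2Deficit (h p.1.1 * h p.1.2 * (h p.1.1)⁻¹ * (h p.1.2)⁻¹) +
        (L : ℝ) ^ 2 * ∑ k : Fin 3, su2Deficit (h k * c * (h k)⁻¹ * c⁻¹) := by
  rw [ringDeficit_constSlices, wilsonAction_combFlat, seamDeficit_combFlat]
  ring

/-- ★★ The same as a COMMUTATOR QUARTIC in unit quaternions (`A_k = q(h_k)`, `C = q(c)`):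
`F₀ = 2L²·Σ_{i<j}‖A_iA_j − A_jA_i‖² + L²·Σ_k‖A_kC − CA_k‖²` — homogeneous of degree four in the imaginary parts (✓`normSq_comm_eq`). [cite: CosteEtAl1985] -/
theorem ringDeficit_combConst_eq_commutator_quartic (h : Fin 3 → SU2) (c : SU2) :
    ringDeficit L (fun _ => false) (fun _ : Fin (2 * L - 1 + 1) => combFlat (L := L) h, fun _ : Site 3 L => c) =
      2 * (L : ℝ) ^ 2 * ∑ p : {p : Fin 3 × Fin 3 // p.1 < p.2}, ‖su2Quat (h p.1.1) * su2Quat (h p.1.2) - su2Quat (h p.1.2) * su2Quat (h p.1.1)‖ ^ 2 +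
        (L : ℝ) ^ 2 * ∑ k : Fin 3, ‖su2Quat (h k) * su2Quat c - su2Quat c * su2Quat (h k)‖ ^ 2 := by
  rw [ringDeficit_combConst]
  simp only [su2Deficit_commutator_eq]

/-- ★ `F₀(comb-const h c) = 0 ↔` the quadruple `(h₀,h₁,h₂,c)` commutes pairwise. [cite: Luscher1983, §2] -/
theorem ringDeficit_combConst_eq_zero_iff (h : Fin 3 → SU2) (c : SU2) :
    ringDeficit L (fun _ => false) (fun _ : Fin (2 * L - 1 + 1) => combFlat (L := L) h, fun _ : Site 3 L => c) = 0 ↔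
      (∀ i j : Fin 3, h i * h j = h j * h i) ∧ (∀ k : Fin 3, h k * c = c * h k) := by
  have hL0 : (0 : ℝ) < L := Nat.cast_pos.mpr (Nat.pos_of_ne_zero (NeZero.ne L))
  have hL2 : (0 : ℝ) < (L : ℝ) ^ 2 := pow_pos hL0 2
  rw [ringDeficit_combConst]
  generalize hs1 : (∑ p : {p : Fin 3 × Fin 3 // p.1 < p.2}, su2Deficit (h p.1.1 * h p.1.2 * (h p.1.1)⁻¹ * (h p.1.2)⁻¹)) = s1
  generalize hs2 : (∑ k : Fin 3, su2Deficit (h k * c * (h k)⁻¹ * c⁻¹)) = s2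
  have hnn1 : ∀ p : {p : Fin 3 × Fin 3 // p.1 < p.2}, 0 ≤ su2Deficit (h p.1.1 * h p.1.2 * (h p.1.1)⁻¹ * (h p.1.2)⁻¹) :=
    fun p => by rw [su2Deficit_commutator_eq]; exact sq_nonneg _
  have hnn2 : ∀ k : Fin 3, 0 ≤ su2Deficit (h k * c * (h k)⁻¹ * c⁻¹) := fun k => by
    rw [su2Deficit_commutator_eq]; exact sq_nonneg _
  have hs1n : 0 ≤ s1 := by rw [← hs1]; exact Finset.sum_nonneg fun p _ => hnn1 p
  have hs2n : 0 ≤ s2 := by rw [← hs2]; exact Finset.sum_nonneg fun k _ => hnn2 k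
  have hscal : 2 * (L : ℝ) ^ 2 * s1 + (L : ℝ) ^ 2 * s2 = 0 ↔ s1 = 0 ∧ s2 = 0 := by
    constructor
    · intro hz
      have hA : 0 ≤ 2 * (L : ℝ) ^ 2 * s1 := mul_nonneg (mul_nonneg (by norm_num) hL2.le) hs1n
      have hB : 0 ≤ (L : ℝ) ^ 2 * s2 := mul_nonneg hL2.le hs2n
      obtain ⟨hA0, hB0⟩ := (add_eq_zero_iff_of_nonneg hA hB).mp hz
      refine ⟨?_, ?_⟩
      · rcases mul_eq_zero.mp hA0 with h' | h'
        · exact absurd h' (mul_ne_zero two_ne_zero hL2.ne')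
        · exact h'
      · rcases mul_eq_zero.mp hB0 with h' | h'
        · exact absurd h' hL2.ne'
        · exact h'
    · rintro ⟨h1, h2⟩
      rw [h1, h2]; ring
  rw [hscal, ← hs1, ← hs2, Finset.sum_eq_zero_iff_of_nonneg (fun p _ => hnn1 p), Finset.sum_eq_zero_iff_of_nonneg (fun k _ => hnn2 k)]
  constructor
  · rintro ⟨hz1, hz2⟩
    refine ⟨fun i j => ?_, fun k => (su2Deficit_commutator_eq_zero_iff _ _).mp (hz2 k (Finset.mem_univ _))⟩
    rcases lt_trichotomy i j with hij | hij | hij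
    · exact (su2Deficit_commutator_eq_zero_iff (h i) (h j)).mp (hz1 ⟨(i, j), hij⟩ (Finset.mem_univ _))
    · subst hij; rfl
    · exact ((su2Deficit_commutator_eq_zero_iff (h j) (h i)).mp (hz1 ⟨(j, i), hij⟩ (Finset.mem_univ _))).symm
  · rintro ⟨h1, h2⟩
    exact ⟨fun p _ => (su2Deficit_commutator_eq_zero_iff _ _).mpr (h1 _ _), fun k _ => (su2Deficit_commutator_eq_zero_iff _ _).mpr (h2 k)⟩

end Summit.QuantumFields.YangMills.Theorems.VirialFluxGap.CombConstant

end
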